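import Mathlib
import HarnessLib
import Summits.Ventures.LatticeQCDFlow.Scoring.SU3RealTraceFixedVector

/-!
# A cube root of unity `ζ` is an eigenvalue of `U ∈ SU(3)` iff `tr U` lies on the spoke `ℝ ζ`

HONEST FRAMING: exact (Metropolis-corrected) sampling algorithms for lattice gauge theory;
figures of merit are autocorrelation/cost numbers at stated couplings and volumes; no
continuum-physics claim.

Venture `LatticeQCDFlow` (cell pub-lqcd), sub-topic `Scoring`; FANOUT row 21 (`su3-base`: the 4D
`SU(3)` baselines).  NEW WORK of the cell (placement rule), elementary, over row 21 GEN-8's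
`Scoring/SU3RealTraceFixedVector` (`su3_exists_fixed_vector_iff_im_trace_eq_zero`: `U` has a FIXED
vector iff `Im tr U = 0`, i.e. `tr U` on the real spoke) and companion of `Scoring/SU3TraceRangeSpokes`
(the three spokes `ζ·[−1, 3]`, `ζ³ = 1`, consist of traces).  No definition is introduced; nothing is
cited as a fact; no number of ours.

The `Z₃` centre turns the real-spoke statement into one for each spoke: for `ζ³ = 1` the matrix
`ζ̄ U` is again in `SU(3)` (`|ζ| = 1`, `ζ̄³ = 1`), `U v = ζ v ⇔ (ζ̄ U) v = v`, and `tr(ζ̄ U) = ζ̄ tr U`;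
so

  `ζ is an eigenvalue of U  ⇔  Im(ζ̄ · tr U) = 0  ⇔  tr U ∈ ℝ ζ`.

The three lines `ℝ, ℝζ, ℝζ̄` through the cusps `3, 3ζ, 3ζ̄` of the deltoid are thus exactly the
loci where the spectrum contains the corresponding cube root of unity; their common point `t = 0`
is the class of `diag(1, ζ, ζ̄)`, which has all three (`SU3TracelessOrderThree`).

## What is proved (`ζ : ℂ`, `ζ ^ 3 = 1`)

* `conj_cubeRoot_smul_mem` — `ζ̄ • U ∈ SU(3)`;
* **`su3_exists_eigenvector_cubeRoot_iff`** — `(∃ v ≠ 0, U v = ζ v) ⇔ Im(ζ̄ tr U) = 0`;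
* `im_conj_mul_eq_zero_iff_mem_spoke` — for `|ζ| = 1`: `Im(ζ̄ t) = 0 ⇔ ∃ s : ℝ, t = ζ s`;
* **`su3_exists_eigenvector_cubeRoot_iff_mem_spoke`** — `(∃ v ≠ 0, U v = ζ v) ⇔ ∃ s : ℝ, tr U = ζ s`.

NOT CLAIMED: anything for `N ≠ 3`; multiplicities of the eigenvalue.
-/

namespace Summit.Ventures.LatticeQCDFlow.Scoring

open Matrix

section SpecialUnitaryThree

/-- For `ζ³ = 1` and `U ∈ SU(3)`, the centre translate `ζ̄ • U` lies in `SU(3)` (the `ζ ↦ ζ̄`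
instance of `SU3AdjointTraceRange.su3_centre_smul_mem`, restated because that module's olean was not
yet available to import at filing time). -/
theorem conj_cubeRoot_smul_mem {ζ : ℂ} (hζ : ζ ^ 3 = 1) (U : Matrix.specialUnitaryGroup (Fin 3) ℂ) :
    (starRingEnd ℂ) ζ • (U : Matrix (Fin 3) (Fin 3) ℂ) ∈ Matrix.specialUnitaryGroup (Fin 3) ℂ := by
  have hU := U.2
  have hunit : (U : Matrix (Fin 3) (Fin 3) ℂ) ∈ Matrix.unitaryGroup (Fin 3) ℂ :=
    (Matrix.mem_specialUnitaryGroup_iff.mp hU).1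
  have hdet : (U : Matrix (Fin 3) (Fin 3) ℂ).det = 1 := (Matrix.mem_specialUnitaryGroup_iff.mp hU).2
  have hn : ‖ζ‖ = 1 := by
    have h : ‖ζ‖ ^ 3 = 1 := by rw [← norm_pow, hζ, norm_one]
    exact (pow_eq_one_iff_of_nonneg (norm_nonneg ζ) (by norm_num)).mp h
  have hζc : (starRingEnd ℂ) ζ * ζ = 1 := by
    rw [← Complex.normSq_eq_conj_mul_self, Complex.normSq_eq_norm_sq, hn]; norm_num
  rw [Matrix.mem_specialUnitaryGroup_iff]
  refine ⟨?_, ?_⟩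
  · rw [Matrix.mem_unitaryGroup_iff, star_smul, Matrix.smul_mul, Matrix.mul_smul, smul_smul,
      Matrix.mem_unitaryGroup_iff.mp hunit, Complex.star_def, Complex.conj_conj, hζc, one_smul]
  · rw [det_smul, hdet, mul_one, Fintype.card_fin, ← map_pow, hζ, map_one]

/-- **A cube root of unity `ζ` is an eigenvalue of `U ∈ SU(3)` iff `Im(ζ̄ · tr U) = 0`** (the
real-spoke criterion of `SU3RealTraceFixedVector` applied to `ζ̄ U ∈ SU(3)`). -/
theorem su3_exists_eigenvector_cubeRoot_iff {ζ : ℂ} (hζ : ζ ^ 3 = 1)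
    (U : Matrix.specialUnitaryGroup (Fin 3) ℂ) :
    (∃ v : Fin 3 → ℂ, v ≠ 0 ∧ (U : Matrix (Fin 3) (Fin 3) ℂ) *ᵥ v = ζ • v) ↔
      ((starRingEnd ℂ) ζ * (U : Matrix (Fin 3) (Fin 3) ℂ).trace).im = 0 := by
  have hn : ‖ζ‖ = 1 := by
    have h : ‖ζ‖ ^ 3 = 1 := by rw [← norm_pow, hζ, norm_one]
    exact (pow_eq_one_iff_of_nonneg (norm_nonneg ζ) (by norm_num)).mp h
  have hζc : (starRingEnd ℂ) ζ * ζ = 1 := by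
    rw [← Complex.normSq_eq_conj_mul_self, Complex.normSq_eq_norm_sq, hn]; norm_num
  have hζc' : ζ * (starRingEnd ℂ) ζ = 1 := by rw [mul_comm]; exact hζc
  have key := su3_exists_fixed_vector_iff_im_trace_eq_zero
    ⟨(starRingEnd ℂ) ζ • (U : Matrix (Fin 3) (Fin 3) ℂ), conj_cubeRoot_smul_mem hζ U⟩
  rw [trace_smul, smul_eq_mul] at key
  rw [← key]
  constructor
  · rintro ⟨v, hv, h⟩
    refine ⟨v, hv, ?_⟩
    rw [smul_mulVec, h, smul_smul, hζc, one_smul]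
  · rintro ⟨v, hv, h⟩
    refine ⟨v, hv, ?_⟩
    rw [smul_mulVec] at h
    calc (U : Matrix (Fin 3) (Fin 3) ℂ) *ᵥ v
        = (ζ * (starRingEnd ℂ) ζ) • ((U : Matrix (Fin 3) (Fin 3) ℂ) *ᵥ v) := by rw [hζc', one_smul]
      _ = ζ • v := by rw [← smul_smul, h]

/-- For `|ζ| = 1`: `Im(ζ̄ t) = 0 ⇔ t ∈ ℝ ζ`. -/
theorem im_conj_mul_eq_zero_iff_mem_spoke {ζ : ℂ} (hn : ‖ζ‖ = 1) (t : ℂ) :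
    ((starRingEnd ℂ) ζ * t).im = 0 ↔ ∃ s : ℝ, t = ζ * s := by
  have hζc' : ζ * (starRingEnd ℂ) ζ = 1 := by
    rw [mul_comm, ← Complex.normSq_eq_conj_mul_self, Complex.normSq_eq_norm_sq, hn]; norm_num
  constructor
  · intro h
    refine ⟨((starRingEnd ℂ) ζ * t).re, ?_⟩
    have hz : (starRingEnd ℂ) ζ * t = ((((starRingEnd ℂ) ζ * t).re : ℝ) : ℂ) := by
      apply Complex.ext
      · simp
      · rw [h]; simp
    calc t = (ζ * (starRingEnd ℂ) ζ) * t := by rw [hζc', one_mul]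
      _ = ζ * ((starRingEnd ℂ) ζ * t) := by rw [mul_assoc]
      _ = ζ * ((((starRingEnd ℂ) ζ * t).re : ℝ) : ℂ) := by rw [← hz]
  · rintro ⟨s, hs⟩
    rw [hs, ← mul_assoc, mul_comm ((starRingEnd ℂ) ζ) ζ, hζc', one_mul, Complex.ofReal_im]

/-- **`ζ` (`ζ³ = 1`) is an eigenvalue of `U ∈ SU(3)` iff `tr U` lies on the spoke `ℝ ζ`** — the three
lines through the cusps `3, 3ζ, 3ζ̄` of the deltoid are exactly the loci where the spectrum contains
the corresponding cube root of unity. -/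
theorem su3_exists_eigenvector_cubeRoot_iff_mem_spoke {ζ : ℂ} (hζ : ζ ^ 3 = 1)
    (U : Matrix.specialUnitaryGroup (Fin 3) ℂ) :
    (∃ v : Fin 3 → ℂ, v ≠ 0 ∧ (U : Matrix (Fin 3) (Fin 3) ℂ) *ᵥ v = ζ • v) ↔
      ∃ s : ℝ, (U : Matrix (Fin 3) (Fin 3) ℂ).trace = ζ * s := by
  have hn : ‖ζ‖ = 1 := by
    have h : ‖ζ‖ ^ 3 = 1 := by rw [← norm_pow, hζ, norm_one]
    exact (pow_eq_one_iff_of_nonneg (norm_nonneg ζ) (by norm_num)).mp h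
  rw [su3_exists_eigenvector_cubeRoot_iff hζ, im_conj_mul_eq_zero_iff_mem_spoke hn]

end SpecialUnitaryThree

end Summit.Ventures.LatticeQCDFlow.Scoring
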